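import Mathlib
import Summits.NavierStokesRegularity.NavierStokesRegularity.Theorems.TaoLadderRungTwoBreakOneShiftWindowCert
import Summits.NavierStokesRegularity.NavierStokesRegularity.Theorems.TaoLadderRungTwoBreakOneShiftT4E3W216
import HarnessLib

/-!
# The one-shift instance T4 @ ε₀ = 3/100, W = 216: the window certificate CONSTRUCTED, and the certificate side restated as
# eight quantitative clauses about kernel-defined objects (cell harvest/h2-tao-ladder, seat p2;
# rung1/RUNG1-P2G9-REPORT.md §36–§37/§40; support for K1(1) = `NoSurvivingDSSOne`, stmt-NavierStokesRegularity-20205)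

MODEL lattice only (comparable circuit table, scale ratio `103/100`); nothing here is a statement about the
Navier–Stokes equations; no item is closed.

`T4E3W216.exists_surviving_dssWave_of_cert` (module …OneShiftT4E3W216) takes a window certificate
`cert : OneShiftWindowCert (frame bd) (3 / 100) αT4` and eight quantitative clauses about `cert`. Here, as for
T4W76 (module …OneShiftT4W76WindowCert):

* `T4E3W216.windowCert bd C hC : OneShiftWindowCert (frame bd) (3 / 100) αT4` is CONSTRUCTED for the frame of the
  row and every preconditioner `C` with `C r = 0 → r = 0` (parts I–IV of …OneShiftWindow*: the window run exists
  on the whole flight by the energy bound — the table is cancelling (`isCancellingCoeff_circuitTable`), the wake tube fits under `Eb = 0.78`, the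
  top tube under `Et = ε`);
* `T4E3W216.ClausesFor bd C hC` — the eight quantitative clauses for THIS certificate (engine v7.5 printed
  numbers of kit j304114); `exists_surviving_dssWave_of_clauses` / `exists_inTableClass_surviving_dssWave_of_clauses`
  conclude.

So for this row too the certificate side is: choose `C` and prove eight inequalities about kernel-defined
objects; no existence clause and no opaque `Nmap` remain. Nothing here proves the eight inequalities.
-/

noncomputable section

-- the sub-problem namespace repeats the summit name by design (D-0017)
set_option linter.dupNamespace false

namespace Summit.NavierStokesRegularity.NavierStokesRegularity.Theorems

namespace DSSOneShift

open Set Literature.Analysis.FluidPDE Literature.Analysis.FluidPDE.TaoCascade CertificateGlueOn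
open OneShiftFrame

namespace T4E3W216

/-- The wake tube at shell `-1` fits under the edge bound `Eb = 0.78`: `|ĝ ŷ_{i,0}| + g_hi (r₀ + κ) ≤ Eb`.
[cite: Tao2016AveragedNS, §4; cell vocabulary, harvest/h2-tao-ladder rung1/RUNG1-P2G9-REPORT.md §36 TABLE 36A (Eb of the row)] -/
theorem tube_edge_bot (bd : BoxData) (i : Fin 4) :
    |(frame bd).tubeC i (-1)| + (frame bd).tubeR (-1) ≤ (frame bd).Eb := by
  have hc := bd.yc_le i
  have h1 : (frame bd).tubeC i (-1) = ghat ^ (0 + 1) * bd.yc i 0 := by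
    rw [frame_tubeC]; exact_mod_cast tubeCT4_wake (fun i => bd.yc i 0) i 0
  have h2 : (frame bd).tubeR (-1) = gHi ^ (0 + 1) * (r₀ + κw * (((0 : ℕ) : ℝ) + 1)) := by
    rw [frame_tubeR]; exact_mod_cast tubeRT4_wake 0
  have h3 : (frame bd).Eb = 39 / 50 := rfl
  rw [h1, h2, h3, abs_mul]
  unfold cmax at hc
  unfold ghat gHi r₀ κw
  norm_num
  nlinarith [abs_nonneg (bd.yc i 0)]

/-- The top tube at shell `W` fits under the edge bound: `0 + ε ≤ ε`. [cite: Tao2016AveragedNS, §4; cell vocabulary, harvest/h2-tao-ladder rung1/RUNG1-P2G9-REPORT.md §36 (Et = ε)] -/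
theorem tube_edge_top (bd : BoxData) (i : Fin 4) :
    |(frame bd).tubeC i (frame bd).W| + (frame bd).tubeR (frame bd).W ≤ (frame bd).Et := by
  have h1 : (frame bd).tubeC i (frame bd).W = 0 := by
    rw [frame_tubeC, frame_W]; exact_mod_cast tubeCT4_top (fun i => bd.yc i 0) i 0
  have h2 : (frame bd).tubeR (frame bd).W = εR * (1 / 2) ^ (0 : ℕ) := by
    rw [frame_tubeR, frame_W]; exact_mod_cast tubeRT4_top 0
  have h3 : (frame bd).Et = εR := rfl
  rw [h1, h2, h3]
  simp

/-- `0 < W`. [folklore] -/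
theorem frame_W_pos (bd : BoxData) : 0 < (frame bd).W := by
  rw [frame_W']; norm_num

/-- **THE WINDOW CERTIFICATE OF THE ROW T4 @ ε₀ = 3/100, W = 216, CONSTRUCTED** for the frame `frame bd` and any
preconditioner `C` of the window block with `C r = 0 → r = 0`.
[cite: Tao2016AveragedNS, §4 Lemma 4.1 (4.8), §5.3; cell vocabulary, harvest/h2-tao-ladder rung1/RUNG1-P2G9-REPORT.md §36–§37/§40] -/
def windowCert (bd : BoxData) (C : (frame bd).WState × ℝ → (frame bd).WState × ℝ)
    (hC : ∀ r, C r = 0 → r = 0) : OneShiftWindowCert (frame bd) (3 / 100) αT4 :=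
  (frame bd).windowCertOfMatrix (by norm_num) (frame_W_pos bd) (isCancellingCoeff_circuitTable _ _ _ _ _) (tube_edge_bot bd)
    (tube_edge_top bd) C hC

/-- **The eight quantitative clauses of the certificate side for the CONSTRUCTED window certificate** (engine
v7.5 printed numbers of kit j304114, exactly the hypotheses of `T4E3W216.exists_surviving_dssWave_of_cert` with
`cert := windowCert bd C hC`). Hypothesis structure; nothing here proves it.
[cite: Tao2016AveragedNS, §4 Lemma 4.1 (4.8), §5.3; cell vocabulary, harvest/h2-tao-ladder rung1/RUNG1-P2G9-REPORT.md §36–§37] -/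
structure ClausesFor (bd : BoxData) (C : (frame bd).WState × ℝ → (frame bd).WState × ℝ)
    (hC : ∀ r, C r = 0 → r = 0) where
  /-- window amplitude hulls -/
  hAwin : ∀ w, (frame bd).Adm w → ∀ j k', (frame bd).InWindow k' → ∀ s ∈ Icc 0 (frame bd).τhi,
    |(frame bd).fullFamily (windowCert bd C hC) w j k' s| ≤ AT4 k'
  /-- the hull of the renormalisation factor -/
  hgl : ∀ w, (frame bd).Adm w →
    gLo ≤ gfac (slice ((frame bd).fullFamily (windowCert bd C hC) w) ((frame bd).decodeTau w)) ∧
    gfac (slice ((frame bd).fullFamily (windowCert bd C hC) w) ((frame bd).decodeTau w)) ≤ gHi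
  /-- window block, edge form -/
  hWedge : ∀ u v, (frame bd).AdmLip RT4 u → (frame bd).AdmLip RT4 v → ∀ B E : ℝ,
    (∀ i, ∀ t ∈ Icc 0 (frame bd).τhi, |(frame bd).decodeTail u i (-1) t - (frame bd).decodeTail v i (-1) t| ≤ B) →
    (∀ i, ∀ t ∈ Icc 0 (frame bd).τhi,
    |(frame bd).decodeTail u i (frame bd).W t - (frame bd).decodeTail v i (frame bd).W t| ≤ E) →
    dist ((frame bd).rawWindow (windowCert bd C hC) u) ((frame bd).rawWindow (windowCert bd C hC) v) ≤
    868 / 10 ^ 6 * dist u v + 233 / 10 ^ 5 * B + 18178 * 10 ^ 20 * E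
  /-- renormalisation factor, edge form -/
  hγedge : ∀ u v, (frame bd).AdmLip RT4 u → (frame bd).AdmLip RT4 v → ∀ B E : ℝ,
    (∀ i, ∀ t ∈ Icc 0 (frame bd).τhi, |(frame bd).decodeTail u i (-1) t - (frame bd).decodeTail v i (-1) t| ≤ B) →
    (∀ i, ∀ t ∈ Icc 0 (frame bd).τhi,
    |(frame bd).decodeTail u i (frame bd).W t - (frame bd).decodeTail v i (frame bd).W t| ≤ E) →
    |gfac (slice ((frame bd).fullFamily (windowCert bd C hC) u) ((frame bd).decodeTau u)) -
    gfac (slice ((frame bd).fullFamily (windowCert bd C hC) v) ((frame bd).decodeTau v))| ≤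
    1073 / 10 ^ 12 * dist u v + 214 / 10 ^ 17 * B + 1 / 10 ^ 60 * E
  /-- left-behind shell `0` at the moving flight time -/
  hZedge : ∀ u v, (frame bd).AdmLip RT4 u → (frame bd).AdmLip RT4 v → ∀ i, ∀ B E : ℝ,
    (∀ i, ∀ t ∈ Icc 0 (frame bd).τhi, |(frame bd).decodeTail u i (-1) t - (frame bd).decodeTail v i (-1) t| ≤ B) →
    (∀ i, ∀ t ∈ Icc 0 (frame bd).τhi,
    |(frame bd).decodeTail u i (frame bd).W t - (frame bd).decodeTail v i (frame bd).W t| ≤ E) →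
    |(frame bd).fullFamily (windowCert bd C hC) u i 0 ((frame bd).decodeTau u) -
    (frame bd).fullFamily (windowCert bd C hC) v i 0 ((frame bd).decodeTau v)| ≤
    767 / 10 ^ 12 * dist u v + 203 / 10 ^ 7 * B + 1 / 10 ^ 60 * E
  /-- every window shell along the flight -/
  hDedge : ∀ u v, (frame bd).AdmLip RT4 u → (frame bd).AdmLip RT4 v → ∀ j k', (frame bd).InWindow k' →
    ∀ s ∈ Icc 0 (frame bd).τhi, ∀ B E : ℝ,
    (∀ i, ∀ t ∈ Icc 0 (frame bd).τhi, |(frame bd).decodeTail u i (-1) t - (frame bd).decodeTail v i (-1) t| ≤ B) →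
    (∀ i, ∀ t ∈ Icc 0 (frame bd).τhi,
    |(frame bd).decodeTail u i (frame bd).W t - (frame bd).decodeTail v i (frame bd).W t| ≤ E) →
    |(frame bd).fullFamily (windowCert bd C hC) u j k' s - (frame bd).fullFamily (windowCert bd C hC) v j k' s| ≤
    vmaxT4 k' * dist u v + χbT4 k' * B + χeT4 k' * E
  /-- Krawczyk inclusion -/
  hwinIn : ∀ u, (frame bd).AdmLip RT4 u →
    (∀ i k, |((frame bd).rawWindow (windowCert bd C hC) u).1 i k| ≤ 1) ∧ |((frame bd).rawWindow (windowCert bd C hC) u).2| ≤ 1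
  /-- wake entry -/
  hA1 : ∀ w, (frame bd).Adm w → ∀ i,
    |gfac (slice ((frame bd).fullFamily (windowCert bd C hC) w) ((frame bd).decodeTau w)) *
    (frame bd).fullFamily (windowCert bd C hC) w i 0 ((frame bd).decodeTau w) - (frame bd).tubeC i (-1)| ≤ 198 / 10 ^ 7

variable (bd : BoxData)

/-- **T4 @ ε₀ = 3/100, W = 216 with the window certificate CONSTRUCTED**: a preconditioner `C` and the eight quantitative clauses
about the kernel-defined window-run / Krawczyk maps yield a surviving admissible DSS blow-up wave of the
bi-infinite lattice at `1 + ε₀ = 103/100`. Conditional on the clauses; model lattice only; does not close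
stmt-20205 (single `(ε₀, α)`).
[cite: Tao2016AveragedNS, §4 Lemma 4.1 (4.8), §5.3–§6; cell vocabulary, harvest/h2-tao-ladder rung1/RUNG1-P2G9-REPORT.md §36–§37, §40] -/
theorem exists_surviving_dssWave_of_clauses {C : (frame bd).WState × ℝ → (frame bd).WState × ℝ}
    {hC : ∀ r, C r = 0 → r = 0} (h : ClausesFor bd C hC) :
    ∃ (T : ℝ) (Φ : Unit → ℝ → Em 4), 0 < T ∧ IsDSSWave (3 / 100) αT4 (Equiv.refl Unit) T Φ ∧
      Surviving 1 (3 / 100) T ∧ ∃ x, Φ () x ≠ 0 :=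
  exists_surviving_dssWave_of_cert bd (windowCert bd C hC) h.hAwin h.hgl h.hWedge h.hγedge h.hZedge h.hDedge
    h.hwinIn h.hA1

/-- The same, packaged with the class membership of the table in `InTableClass 15`. [cite: Tao2016AveragedNS, §4 (4.2)–(4.3), §6.1; cell vocabulary (`InTableClass`)] -/
theorem exists_inTableClass_surviving_dssWave_of_clauses {C : (frame bd).WState × ℝ → (frame bd).WState × ℝ}
    {hC : ∀ r, C r = 0 → r = 0} (h : ClausesFor bd C hC) :
    ∃ α : Fin 4 → Fin 4 → Fin 4 → ℤ × ℤ × ℤ → ℝ, InTableClass 15 α ∧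
      ∃ (T : ℝ) (Φ : Unit → ℝ → Em 4), 0 < T ∧ IsDSSWave (3 / 100) α (Equiv.refl Unit) T Φ ∧
        Surviving 1 (3 / 100) T ∧ ∃ x, Φ () x ≠ 0 :=
  exists_inTableClass_surviving_dssWave_of_cert bd (windowCert bd C hC) h.hAwin h.hgl h.hWedge h.hγedge h.hZedge
    h.hDedge h.hwinIn h.hA1

end T4E3W216

end DSSOneShift

end Summit.NavierStokesRegularity.NavierStokesRegularity.Theorems
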